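import Literature.AnabelianGeometry.EtaleTheta.Discharge.Sec3Prop34CnstOfRlfRChainModel
import Literature.AnabelianGeometry.EtaleTheta.TemperedFrobenioidToyGenuineR
import HarnessLib

/-!
# [EtTh] Def. 3.6 (ii) at the `Ÿ`-type CHAIN MODEL: a tempered Frobenioid of monoid type `ℝ` over the chain data
# (non-vacuity of the `C₀`-binder of `thm37_iii_withCnst_ofRlfR_chain`; Thm. 3.7 (iii)/(iv)/(i), Rmk. 3.6.3 OUTRIGHT)

S. Mochizuki, *The étale theta function and its Frobenioid-theoretic manifestations*, Publ. RIMS **45** (2009)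
[MochizukiEtTh2009], Def. 3.6 (i)–(ii) PDF pp. 76–77, Rmk. 3.6.3 p. 79, Thm. 3.7 (i)/(iii)/(iv) pp. 79–80,
Prop. 3.4 (ii) p. 74; S. Mochizuki, *The geometry of Frobenioids I* [MochizukiFrdI2008], Thm. 5.2 (ii) p. 100.
abc-iut cell, layer L2, sub-DAG `plan/L2/SUBDAG-EtTh-Thm37.md` row «Thm3.7(iii)/L10-R», GAP-LEDGER G-w5d130-1
(`Ÿ`-type case); seat abc-iut-w6-d061 (gen 4).  MODEL-CONSTRUCTION companion («class (b)»: one structure-instance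
`def` + three auxiliary `def`s, the rest theorems; new path, nothing landed edited) of abc-iut-w6-d046's
`Discharge/Sec3Prop34CnstOfRlfRChainModel.lean` (the `Ÿ`-type chain data `dm`: primes `ℤ ⊔ ℤ`, `Φ₀ = ∏_{ℤ⊔ℤ} ℚ_{≥0}`,
`B₀ = (ℤ → ℤ)` with the law (L), `F₀ =` constants; Prop. 3.4 / `hE` / `Prop34Cnst (ofRlfR dm hpf) (𝟭 _)` PROVED there;
Thm. 3.7 (iii) stated for EVERY `C₀ : TemperedFrobenioid (ofRlfR dm hpf) Dc VD`).  The tree's only inhabitant of a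
`TemperedFrobenioid (ofRlfR _ _) _ _` so far is abc-iut-f-136's ONE-PRIME toy `Toy.genuineTemperedFrobenioidR`; THIS
FILE builds one OVER THE CHAIN DATA (infinitely many `ℚ`-primes, infinitely supported divisors):
* `chainΦ` — `Φ(A) := im(Φ₀(A)^pf → Φ₀(A)^rlf)`, group-saturated (abc-iut-w5-d164's `Example39NV`), PERF-FACTORIAL
  (`≅ Φ₀^pf ≅ Φ₀ = ∏ ℚ_{≥0}`, abc-iut-w6-d046's `PiNNRat.isPerfFactorial`, transported), divisorial;
* **`Φ^{bs-fld}(A) = ℚ_{≥0} · div(𝟙)` is MONOPRIME** (`chainΦ_inf_cnstR_eq`, `bsFldEquiv`) — the field with content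
  at infinitely many primes: an element of `Φ₀` whose image lies in `ℝ·Φ₀^cnst = ℝ · ι(div 𝟙)` has equal component
  coordinates and vanishing cusp coordinates (the prime coordinates of `∏ ℚ_{≥0}` are the evaluations,
  `PiNNRat.exists_coord_eq_mul_eval`, as in abc-iut-w6-d046's `eff`); (b) `ι(div₀ 𝟙) ∈ F₀^ℝ` has divisor `ι(𝟙)/1 ≠ 1`;
* `chainTemperedFrobenioidR R S : TemperedFrobenioid (ofRlfR dm hpf) (Discrete PUnit) (treeCatVocab _ R S)`,
  `isFrobenioid_chainTemperedFrobenioidR` ([FrdI] Thm. 5.2 (ii)), and OUTRIGHT at the inhabitant BY NAME: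
  Thm. 3.7 (iii) (`thm37_iii_withCnst_ofRlfR_chain`), Rmk. 3.6.3 (`remark363_ofRlfR`, abc-iut-f-136), Thm. 3.7 (iv)
  and (i) "unit-trivial" (`thm37_iv_ofRlfR`, `thm37_i_unitTrivial_ofRlfR`), `nonempty_temperedFrobenioid_ofRlfR_chain`.
HONEST LABEL: a MODEL inhabitant over the cell's abstract interfaces — consistency / instantiation evidence for the
`ofRlfR`-indexed theorems; NOT the tempered Frobenioid of a curve; nothing here bears on [IUTchIII] Cor. 3.12; no side
taken; typed ≠ proved.
-/

noncomputable section

namespace Literature.AnabelianGeometry.EtaleTheta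

open CategoryTheory Opposite Literature.AlgebraicGeometry.Frobenioids NNReal

namespace Sec3Prop34CnstOfRlfRChainModel

/-- Perf-factoriality transports along isomorphisms of monoids — the term of
`Literature.AlgebraicGeometry.Frobenioids.IsPerfFactorial.of_mulEquiv` (`GlobalLGPFrobenioidsModFrakPerfFactorial.lean`),
inlined privately to keep this L2 file's import closure inside [FrdI]/[EtTh]. [cite: MochizukiFrdI2008, Def. 2.4(i) p.47] -/
private theorem isPerfFactorial_of_mulEquiv {N N' : Type} [CommMonoid N] [CommMonoid N'] (e : N ≃* N')
    (h : IsPerfFactorial N) : IsPerfFactorial N' :=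
  IsPerfFactorial.of_cond (h.isDivisorial.of_mulEquiv e)
    (fun 𝔭' => (h.isMonoprime (Primes.congr e.symm 𝔭')).of_mulEquiv
      (Primes.submonoidCongr e (Primes.congr e.symm 𝔭') 𝔭' (Primes.congr_apply_congr_symm e 𝔭')))
    (Factorization.Cond.of_mulEquiv (AlgebraicGeometry.Frobenioids.Perfection.congr e) h.cond)

/-- The realified data of monoid type `ℝ` over the chain data: `ofRlfR dm hpf` (`Φ₀^ℝ = Φ₀^rlf`,
`B₀^ℝ = ℝ·Φ₀^birat`, `F₀^ℝ = ℝ·Φ₀^cnst`). [cite: MochizukiEtTh2009, Def 3.6 p.76] -/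
abbrev realifiedChainR : RealifiedDivisorMonoids (D₀ := Discrete PUnit.{1}) treeMonoidVocab.{0} :=
  RealifiedDivisorMonoids.ofRlfR dm hpf

/-! ### `Φ := im(Φ₀^pf → Φ₀^rlf)` at the chain data -/

/-- `Φ(Y) := im(Φ₀(Y)^pf → Φ₀(Y)^rlf) ⊆ Φ^{ℝ-log}(Y)`. [cite: MochizukiEtTh2009, Def 3.6 p.76] -/
def chainΦcarrier (Y : (Discrete PUnit.{1})ᵒᵖ) : Submonoid (realifiedChainR.ΦR.obj Y) :=
  MonoidHom.mrange (hpf Y).toRealification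

/-- **`Φ(Y)` is perf-factorial**: `Φ(Y) ≅ Φ₀(Y)^pf ≅ Φ₀(Y) = ∏_{ℤ⊔ℤ} ℚ_{≥0}`, which is perf-factorial
(abc-iut-w6-d046's `PiNNRat.isPerfFactorial`). [cite: MochizukiFrdI2008, Def. 2.4(i) p.48] -/
theorem isPerfFactorial_chainΦcarrier (Y : (Discrete PUnit.{1})ᵒᵖ) : IsPerfFactorial ↥(chainΦcarrier Y) :=
  isPerfFactorial_of_mulEquiv
    ((PiNNRat.eM (ι := I)).trans
      (MulEquiv.ofBijective _ (Example39NV.mrangeRestrict_toRealification_bijective (hpf Y))))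
    PiNNRat.isPerfFactorial

/-- `Φ ⊆ Φ^{ℝ-log} := Φ₀^ℝ|_D` over the identity base functor, stable under pull-back
(`Φ₀(f)^rlf ∘ ι = ι ∘ Φ₀(f)^pf`). [cite: MochizukiEtTh2009, Def 3.6 p.76] -/
def chainΦ : SubMonoidOn ((𝟭 (Discrete PUnit.{1})).op ⋙ realifiedChainR.ΦR) where
  carrier A := chainΦcarrier A
  map_mem := by
    rintro A B f _ ⟨a, rfl⟩
    refine ⟨AlgebraicGeometry.Frobenioids.Perfection.map (dm.Φ₀.map f).hom a, ?_⟩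
    have h := DFunLike.congr_fun (rlfMap_comp_toRealification dm.Φ₀ hpf f) a
    simp only [MonoidHom.comp_apply] at h
    exact h.symm

/-! ### The constants `q · 𝟙_components ∈ Φ₀` and their images -/

/-- `q ↦ (q on every component, 0 at every cusp) ∈ Φ₀ = ∏_{ℤ⊔ℤ} ℚ_{≥0}`, a homomorphism `ℚ_{≥0} → Φ₀`
(the divisors `q · Σ_j C_j`). [cite: MochizukiEtTh2009, Def 3.3 p.73] -/
def cmpHom : Multiplicative ℚ≥0 →* M where
  toFun q i := Sum.elim (fun _ => q) (fun _ => (1 : Multiplicative ℚ≥0)) i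
  map_one' := funext fun i => by cases i <;> rfl
  map_mul' a b := funext fun i => by
    cases i
    · rfl
    · exact (mul_one _).symm

/-- `cmpHom q` at a component. [cite: MochizukiEtTh2009, Def 3.3 p.73] -/
@[simp] theorem cmpHom_inl (q : Multiplicative ℚ≥0) (j : ℤ) : cmpHom q (Sum.inl j) = q := rfl
/-- `cmpHom q` at a cusp. [cite: MochizukiEtTh2009, Def 3.3 p.73] -/
@[simp] theorem cmpHom_inr (q : Multiplicative ℚ≥0) (j : ℤ) : cmpHom q (Sum.inr j) = 1 := rfl

/-- `ℚ_{≥0} → Φ^{ℝ-log}(Y)`, `q ↦ ι(q · 𝟙_components)`. [cite: MochizukiEtTh2009, Def 3.6 p.77] -/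
def bsFldHom (Y : (Discrete PUnit.{1})ᵒᵖ) : Multiplicative ℚ≥0 →* realifiedChainR.ΦR.obj Y :=
  ((hpf Y).toRealification.comp (AlgebraicGeometry.Frobenioids.Perfection.of _)).comp cmpHom

/-! ### Prime coordinates at the chain data: evaluations -/

/-- The coordinate of `ι(m)` at `𝔮'` is `κ_𝔮' · m(j(𝔮'))` (as a real number), for the constant `κ_𝔮' ≠ 0` of
`PiNNRat.exists_coord_eq_mul_eval`. [cite: MochizukiFrdI2008, Def. 2.4(i) p.47] -/
theorem coord_toR (𝔮' : Primes (AlgebraicGeometry.Frobenioids.Perfection M)) {κ : ℝ≥0}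
    (hκ : ∀ m : M, Multiplicative.toAdd (PrimeCoord.coord PiNNRat.isPerfFactorial 𝔮' (PiNNRat.chart 𝔮')
      (PiNNRat.isPerfFactorial.toRealification (AlgebraicGeometry.Frobenioids.Perfection.of _ m))) =
        κ * ((Multiplicative.toAdd (m (PiNNRat.jdx 𝔮')) : ℚ≥0) : ℝ≥0))
    (m : M) :
    ((Multiplicative.toAdd (PrimeCoord.coord PiNNRat.isPerfFactorial 𝔮' (PiNNRat.chart 𝔮')
      ((PiNNRat.isPerfFactorial (ι := I)).toRealification (AlgebraicGeometry.Frobenioids.Perfection.of _ m))) : ℝ≥0) : ℝ) =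
      (κ : ℝ) * ((Multiplicative.toAdd (m (PiNNRat.jdx 𝔮')) : ℚ≥0) : ℝ) := by
  rw [hκ m, NNReal.coe_mul]
  rfl

/-- The divisor of a CONSTANT function `z`: `z` at every component, `0` at every cusp (`Δ²` of a constant vanishes).
[cite: MochizukiEtTh2009, Def 3.3 p.73] -/
theorem realD_const (z : ℤ) (i : I) : (D (fun (_ : ℤ) => z) i : ℝ) = Sum.elim (fun _ => (z : ℝ)) (fun _ => 0) i := by
  rcases i with j | j
  · simp [D_inl]
  · simp [D_inr, lap]
    ring

/-- Elements of `Φ₀^cnst`'s generated subgroup are divisors of CONSTANT functions: `c = div₀(z)` for some `z ∈ ℤ`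
(`F₀ =` constants is already a group). [cite: MochizukiEtTh2009, Def 3.3 p.73] -/
theorem exists_const_of_mem_cnstGp (X : Discrete PUnit.{1}) {c : Algebra.GrothendieckGroup (dm.Φ₀.obj (op X))}
    (hc : c ∈ dm.cnstGp.carrier X) : ∃ z : ℤ, c = divH (Multiplicative.ofAdd fun (_ : ℤ) => z) := by
  induction hc using Subgroup.closure_induction with
  | mem y hy =>
    obtain ⟨g, hg, rfl⟩ := hy
    obtain ⟨z, hz⟩ := hg
    refine ⟨z, ?_⟩
    change divH g = _
    rw [← hz, ofAdd_toAdd]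
  | one => exact ⟨0, (map_one divH).symm⟩
  | mul y y' _ _ hy hy' =>
    obtain ⟨a, rfl⟩ := hy
    obtain ⟨b, rfl⟩ := hy'
    exact ⟨a + b, (map_mul divH (Multiplicative.ofAdd fun (_ : ℤ) => a) (Multiplicative.ofAdd fun (_ : ℤ) => b)).symm⟩
  | inv y _ hy =>
    obtain ⟨a, rfl⟩ := hy
    exact ⟨-a, (map_inv divH (Multiplicative.ofAdd fun (_ : ℤ) => a)).symm⟩

/-- The products defining `ℝ·Φ₀^cnst` at the chain data, in the home of the prime coordinates (definitional).
[cite: MochizukiFrdI2008, Prop. 5.3 p.103] -/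
theorem prod_rsmul_toRlfGp_divH_eq (Y : (Discrete PUnit.{1})ᵒᵖ) {n : ℕ} (r : Fin n → ℝ) (d : Fin n → ℤ → ℤ) :
    (∏ k, (RealifiedDivisorMonoids.realData dm hpf).rsmul (unop Y) (r k)
        ((RealifiedDivisorMonoids.realData dm hpf).toRlfGp (unop Y) (divH (Multiplicative.ofAdd (d k))))) =
      ∏ k, IsPerfFactorial.Rlf.realSMul PiNNRat.isPerfFactorial (r k)
        (PiNNRat.ιg (PiNNRat.toGp (D (d k)))) :=
  rfl

/-! ### `Φ^{bs-fld} = ℚ_{≥0} · div(𝟙)` -/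

/-- `[ι(q · 𝟙_components)] = q • [ι(div 𝟙)]` in `(Φ₀^rlf)^gp` (compare prime coordinates). [cite: MochizukiEtTh2009, Def 3.6 p.77] -/
theorem of_toR_cmpHom_eq (q : Multiplicative ℚ≥0) :
    (Algebra.GrothendieckGroup.of ((PiNNRat.isPerfFactorial (ι := I)).toRealification
        (AlgebraicGeometry.Frobenioids.Perfection.of _ (cmpHom q))) :
        Algebra.GrothendieckGroup (PiNNRat.isPerfFactorial (ι := I)).Rlf) =
      IsPerfFactorial.Rlf.realSMul PiNNRat.isPerfFactorial ((Multiplicative.toAdd q : ℚ≥0) : ℝ)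
        (PiNNRat.ιg (PiNNRat.toGp (D (Multiplicative.toAdd unif)))) := by
  refine PrimeCoord.eq_of_coordGp_eq PiNNRat.chart fun 𝔮' => ?_
  obtain ⟨κ, -, hκ⟩ := PiNNRat.exists_coord_eq_mul_eval 𝔮' (PiNNRat.chart 𝔮')
  apply Multiplicative.toAdd.injective
  rw [PrimeCoord.toAdd_coordGp_realSMul, PrimeCoord.toAdd_coordGp_of, coord_toR 𝔮' hκ]
  change _ = _ * PiNNRat.X 𝔮' (PiNNRat.chart 𝔮') (PiNNRat.toGp (D (Multiplicative.toAdd unif)))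
  rw [PiNNRat.X_toGp _ _ hκ, D_unif]
  cases PiNNRat.jdx 𝔮' with
  | inl j => simp only [cmpHom_inl, Sum.elim_inl]; ring
  | inr j => simp only [cmpHom_inr, Sum.elim_inr, toAdd_one, NNRat.cast_zero, mul_zero]

/-- `ι(q · 𝟙_components)` lies in `ℝ·Φ₀^cnst(Y)`: it is `q • ι(div₀ 𝟙)`. [cite: MochizukiEtTh2009, Def 3.6 p.77] -/
theorem of_bsFldHom_mem_cnstR (Y : (Discrete PUnit.{1})ᵒᵖ) (q : Multiplicative ℚ≥0) :
    Algebra.GrothendieckGroup.of (bsFldHom Y q) ∈ realifiedChainR.cnstR Y := by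
  have hmem : (RealifiedDivisorMonoids.realData dm hpf).rsmul (unop Y) ((Multiplicative.toAdd q : ℚ≥0) : ℝ)
      ((RealifiedDivisorMonoids.realData dm hpf).toRlfGp (unop Y) (dm.div₀ Y unif)) ∈ realifiedChainR.cnstR Y :=
    Subgroup.subset_closure ⟨_, dm.div₀ Y unif, dm.mem_cnstGp_of_mem_cnst (unop Y) ⟨unif, unif_mem, rfl⟩, rfl⟩
  have heq : Algebra.GrothendieckGroup.of (bsFldHom Y q) =
      (RealifiedDivisorMonoids.realData dm hpf).rsmul (unop Y) ((Multiplicative.toAdd q : ℚ≥0) : ℝ)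
        ((RealifiedDivisorMonoids.realData dm hpf).toRlfGp (unop Y) (dm.div₀ Y unif)) :=
    of_toR_cmpHom_eq q
  rw [heq]
  exact hmem

/-- **An element of `Φ(Y)` with image in `ℝ·Φ₀^cnst(Y)` is `ι(q · 𝟙_components)` for some `q ∈ ℚ_{≥0}`**: write it
as `ι(m)` and its class as `∏_k r_k • ι(div₀ z_k)` with constants `z_k`; reading the prime coordinates (the
evaluations) gives `m = C := Σ r_k z_k` on every component and `m = 0` at every cusp, so `m = m(C_0) · 𝟙_components`.
[cite: MochizukiEtTh2009, Def 3.6 p.77] -/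
theorem exists_eq_bsFldHom_of_mem (Y : (Discrete PUnit.{1})ᵒᵖ) {x : realifiedChainR.ΦR.obj Y}
    (hx : x ∈ chainΦcarrier Y) (hc : Algebra.GrothendieckGroup.of x ∈ realifiedChainR.cnstR Y) :
    ∃ q : Multiplicative ℚ≥0, bsFldHom Y q = x := by
  classical
  -- `x = ι(m)` for some `m ∈ Φ₀(Y)` (`Φ₀ = ∏ ℚ_{≥0}` is perfect, so `Φ₀ → Φ₀^pf` is onto)
  obtain ⟨a, rfl⟩ := hx
  obtain ⟨m, rfl⟩ := (isPerfect_iff_bijective_of.mp (PiNNRat.isPerfect (ι := I))).2 a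
  -- the class of `ι(m)` as a real combination of divisors of constants
  obtain ⟨n, r, cvec, hcvec, hprod⟩ :=
    RealificationDataLemmas.exists_prod_rsmul_of_mem_realSpan (RealifiedDivisorMonoids.realData dm hpf) dm.cnstGp
      (unop Y) hc
  have hz' : ∀ k, ∃ z : ℤ, cvec k = divH (Multiplicative.ofAdd fun (_ : ℤ) => z) :=
    fun k => exists_const_of_mem_cnstGp (unop Y) (hcvec k)
  choose z hz using hz'
  simp only [hz] at hprod
  rw [prod_rsmul_toRlfGp_divH_eq] at hprod
  -- read the coordinates: `κ · m(j(𝔮')) = κ · Σ r_k · D(z_k)(j(𝔮'))`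
  have hcoord : ∀ 𝔮', ((Multiplicative.toAdd (m (PiNNRat.jdx 𝔮')) : ℚ≥0) : ℝ) =
      Sum.elim (fun _ => ∑ k, r k * (z k : ℝ)) (fun _ => 0) (PiNNRat.jdx 𝔮') := by
    intro 𝔮'
    obtain ⟨κ, hκ0, hκ⟩ := PiNNRat.exists_coord_eq_mul_eval 𝔮' (PiNNRat.chart 𝔮')
    have h1 := congrArg (fun ξ => Multiplicative.toAdd (PrimeCoord.coordGp PiNNRat.isPerfFactorial 𝔮' (PiNNRat.chart 𝔮') ξ))
      hprod
    rw [PiNNRat.toAdd_coordGp_prod_realSMul_toGp 𝔮' (PiNNRat.chart 𝔮') hκ] at h1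
    have h2 := ((coord_toR 𝔮' hκ m).symm.trans
      ((PrimeCoord.toAdd_coordGp_of 𝔮' (PiNNRat.chart 𝔮') _).symm.trans h1))
    have hκpos : (0 : ℝ) < κ := NNReal.coe_pos.mpr (pos_iff_ne_zero.mpr hκ0)
    have h3 : ((Multiplicative.toAdd (m (PiNNRat.jdx 𝔮')) : ℚ≥0) : ℝ) =
        ∑ k, r k * (D (fun (_ : ℤ) => z k) (PiNNRat.jdx 𝔮') : ℝ) :=
      mul_left_cancel₀ hκpos.ne' h2
    rw [h3]
    cases PiNNRat.jdx 𝔮' with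
    | inl j =>
      simp only [Sum.elim_inl]
      exact Finset.sum_congr rfl fun k _ => by rw [realD_const, Sum.elim_inl]
    | inr j =>
      simp only [Sum.elim_inr]
      exact Finset.sum_eq_zero fun k _ => by rw [realD_const, Sum.elim_inr, mul_zero]
  -- hence `m = m(C_0) · 𝟙_components`
  have hval : ∀ i : I, ((Multiplicative.toAdd (m i) : ℚ≥0) : ℝ) = Sum.elim (fun _ => ∑ k, r k * (z k : ℝ)) (fun _ => 0) i := by
    intro i
    have h := hcoord (Primes.congr PiNNRat.eM (PiMonoprime.primeOf PiNNRat.hP i))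
    rwa [PiNNRat.jdx_congr_primeOf] at h
  have hm : cmpHom (m (Sum.inl 0)) = m := by
    funext i
    rcases i with j | j
    · rw [cmpHom_inl]
      have h1 := hval (Sum.inl j)
      have h0 := hval (Sum.inl 0)
      simp only [Sum.elim_inl] at h1 h0
      have h2 : (Multiplicative.toAdd (m (Sum.inl 0)) : ℚ≥0) = Multiplicative.toAdd (m (Sum.inl j)) := by
        exact_mod_cast h0.trans h1.symm
      exact Multiplicative.toAdd.injective h2
    · rw [cmpHom_inr]
      have h1 := hval (Sum.inr j)
      simp only [Sum.elim_inr] at h1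
      have h2 : (Multiplicative.toAdd (m (Sum.inr j)) : ℚ≥0) = 0 := by exact_mod_cast h1
      have h3 : m (Sum.inr j) = Multiplicative.ofAdd 0 := by rw [← h2, ofAdd_toAdd]
      exact h3.symm
  exact ⟨m (Sum.inl 0),
    congrArg (⇑((hpf Y).toRealification.comp (AlgebraicGeometry.Frobenioids.Perfection.of _))) hm⟩

/-- **`Φ^{bs-fld}(Y) = Φ(Y) ∩ ℝ·Φ₀^cnst(Y)` is the image of `ℚ_{≥0} → Φ^{ℝ-log}(Y)`, `q ↦ ι(q · 𝟙_components)`.**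
[cite: MochizukiEtTh2009, Def 3.6 p.77] -/
theorem chainΦ_inf_cnstR_eq (Y : (Discrete PUnit.{1})ᵒᵖ) :
    chainΦcarrier Y ⊓ (realifiedChainR.cnstR Y).toSubmonoid.comap Algebra.GrothendieckGroup.of =
      MonoidHom.mrange (bsFldHom Y) := by
  ext x
  constructor
  · rintro ⟨hx, hc⟩
    exact exists_eq_bsFldHom_of_mem Y hx hc
  · rintro ⟨q, rfl⟩
    exact ⟨⟨_, rfl⟩, of_bsFldHom_mem_cnstR Y q⟩

/-- `ι(q · 𝟙_components) = ι(q' · 𝟙_components)` forces `q = q'` (read the coordinate at the component `C_0`).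
[cite: MochizukiFrdI2008, Def. 2.4(i) p.47] -/
theorem bsFldHom_injective (Y : (Discrete PUnit.{1})ᵒᵖ) : Function.Injective (bsFldHom Y) := by
  intro q q' h
  have h' : (hpf Y).toRealification (AlgebraicGeometry.Frobenioids.Perfection.of _ (cmpHom q)) =
      (hpf Y).toRealification (AlgebraicGeometry.Frobenioids.Perfection.of _ (cmpHom q')) := h
  have h1 := Example39NV.toRealification_injective (hpf Y) h'
  have h2 : cmpHom q = cmpHom q' := (isPerfect_iff_bijective_of.mp (PiNNRat.isPerfect (ι := I))).1 h1
  exact congrFun h2 (Sum.inl 0)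

/-- **`Φ^{bs-fld}(Y) ≅ ℚ_{≥0}`.** [cite: MochizukiEtTh2009, Def 3.6 p.77] -/
def bsFldEquiv (Y : (Discrete PUnit.{1})ᵒᵖ) :
    ↥(chainΦcarrier Y ⊓ (realifiedChainR.cnstR Y).toSubmonoid.comap Algebra.GrothendieckGroup.of) ≃*
      Multiplicative ℚ≥0 :=
  (MulEquiv.submonoidCongr (chainΦ_inf_cnstR_eq Y)).trans
    (MulEquiv.ofBijective (bsFldHom Y).mrangeRestrict
      ⟨fun _ _ h => bsFldHom_injective Y (congrArg Subtype.val h), MonoidHom.mrangeRestrict_surjective _⟩).symm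

/-! ### Def. 3.6 (ii)(b): the constant `ι(div₀ 𝟙)` has a nonzero divisor in `Φ` -/

/-- The constant function `ι(div₀ 𝟙) ∈ B₀^ℝ(Y) = ℝ·Φ₀^birat(Y)` (its image in `(Φ₀^ℝ)^gp(Y)` lies in the span of
`Φ₀^birat`). [cite: MochizukiEtTh2009, Def 3.6 p.76] -/
def cnstFnR (Y : (Discrete PUnit.{1})ᵒᵖ) : realifiedChainR.BΛ.obj Y :=
  ⟨EtaleTheta.gpMap (realifiedChainR.toR Y) (dm.div₀ Y unif), by
    have h := (RealifiedDivisorMonoids.realData dm hpf).toRlfGp_mem_realSpan dm.biratGp (unop Y)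
      (c := dm.div₀ Y unif) (Subgroup.subset_closure ⟨unif, rfl⟩)
    rw [RealifiedDivisorMonoids.toRlfGp_realData_eq] at h
    exact h⟩

/-- `ι(div₀ 𝟙) ∈ F₀^ℝ(Y) = B₀^ℝ(Y) ∩ ℝ·Φ₀^cnst(Y)` (`𝟙 ∈ F₀`, `Φ₀^cnst ⊆ ℝ·Φ₀^cnst`). [cite: MochizukiEtTh2009, Def 3.6 p.76] -/
theorem cnstFnR_mem_FΛ (Y : (Discrete PUnit.{1})ᵒᵖ) : cnstFnR Y ∈ realifiedChainR.FΛ Y :=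
  realifiedChainR.cnst_le_cnstR Y unif unif_mem

/-- `div₀(𝟙) = [𝟙_components]` in `Φ₀(Y)^gp` (the divisor `Σ_j C_j`, no cusps). [cite: MochizukiEtTh2009, Def 3.3 p.73] -/
theorem div₀_unif_eq_of (Y : (Discrete PUnit.{1})ᵒᵖ) :
    dm.div₀ Y unif = Algebra.GrothendieckGroup.of (cmpHom (Multiplicative.ofAdd 1)) := by
  change divH unif = _
  rw [divH_apply]
  refine PiNNRat.eq_of_c_eq fun i => ?_
  rw [PiNNRat.c_toGp, PiNNRat.c_of]
  rcases i with j | j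
  · simp [unif, D_inl]
  · simp [unif, D_inr, lap]

/-- `ι(𝟙_components) ≠ 1` in `Φ^{ℝ-log}(Y)` (`Φ₀ ≅ Φ₀^pf ↪ Φ₀^rlf`). [cite: MochizukiEtTh2009, Def 3.6 p.77] -/
theorem bsFldHom_one_ne_one (Y : (Discrete PUnit.{1})ᵒᵖ) : bsFldHom Y (Multiplicative.ofAdd 1) ≠ 1 := by
  intro h
  rw [← map_one (bsFldHom Y)] at h
  have h1 := bsFldHom_injective Y h
  exact one_ne_zero (ofAdd_eq_one.mp h1)

variable (R S : ((Discrete PUnit.{1})ᵒᵖ ⥤ CommMonCat.{0}) → Prop)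

/-! ### The tempered Frobenioid of monoid type `ℝ` over the chain data -/

/-- **Def. 3.6 (ii) data of monoid type `ℝ` OVER THE `Ÿ`-TYPE CHAIN DATA and the tree's genuine [FrdI]
vocabularies**: `D := Discrete PUnit → D₀` the identity, `Φ := im(Φ₀^pf → Φ₀^rlf)` (group-saturated,
perf-factorial, divisorial), (a) `Φ^{bs-fld} = ℚ_{≥0}·div(𝟙)` monoprime, (b) `ι(div₀ 𝟙) ∈ F₀^ℝ` has divisor
`ι(𝟙_components)/1 ≠ 1`.  `R`, `S` = the [FrdI] Def. 4.5 predicates, parameters as in `treeCatVocab`.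
[cite: MochizukiEtTh2009, Def 3.6 p.77] -/
def chainTemperedFrobenioidR :
    TemperedFrobenioid realifiedChainR (Discrete PUnit.{1}) (treeCatVocab (Discrete PUnit.{1}) R S) where
  isConnected := Toy.temperedFrobenioid.isConnected
  isTotallyEpimorphic := Toy.temperedFrobenioid.isTotallyEpimorphic
  base := 𝟭 _
  Φ := chainΦ
  isGroupSaturated A := Example39NV.isGroupSaturated_mrange_toRealification (hpf A)
  isPerfFactorial A := isPerfFactorial_chainΦcarrier A
  isDivisorialOn := by
    rw [treeCatVocab_isDivisorialOn]
    exact ⟨Cor38Toy.isMonoidOn_of_punit _, fun A => (isPerfFactorial_chainΦcarrier (op A)).isDivisorial⟩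
  isMonoprime_bsFld A := IsMonoprime.ofQ ⟨⟨bsFldEquiv A⟩⟩
  exists_FΛ_div_ne A := by
    refine ⟨cnstFnR A, cnstFnR_mem_FΛ A, bsFldHom A (Multiplicative.ofAdd 1), ⟨_, rfl⟩, 1, one_mem _,
      bsFldHom_one_ne_one A, ?_⟩
    show EtaleTheta.gpMap (realifiedChainR.toR A) (dm.div₀ A unif) = _
    simp only [map_one, div_one]
    exact (congrArg (EtaleTheta.gpMap (realifiedChainR.toR A)) (div₀_unif_eq_of A)).trans (EtaleTheta.gpMap_of _ _)

/-- Its monoid type is `ℝ`. [cite: MochizukiEtTh2009, Def 3.6 p.77] -/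
theorem chainTemperedFrobenioidR_monoidType : (chainTemperedFrobenioidR R S).monoidType = MonoidType.R := rfl

/-- **`TemperedFrobenioid (ofRlfR dm hpf) _ _` is inhabited at the chain data** — the `C₀`-binder of
abc-iut-w6-d046's `thm37_iii_withCnst_ofRlfR_chain` is non-vacuous. [cite: MochizukiEtTh2009, Def 3.6 p.77] -/
theorem nonempty_temperedFrobenioid_ofRlfR_chain :
    Nonempty (TemperedFrobenioid (RealifiedDivisorMonoids.ofRlfR dm hpf) (Discrete PUnit.{1})
      (treeCatVocab (Discrete PUnit.{1}) R S)) :=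
  ⟨chainTemperedFrobenioidR R S⟩

/-! ### The model Frobenioid IS a Frobenioid; Thm. 3.7 (iii), Rmk. 3.6.3, Thm. 3.7 (iv)/(i) OUTRIGHT -/

/-- **The chain inhabitant is a Frobenioid** (`hF`), by [FrdI] Thm. 5.2 (ii) (`ModelFrobenioid.isFrobenioid`):
`Φ`, `B` monoids on the one-object base, `Φ` divisorial, `B` group-like, `D` connected and totally epimorphic.
[cite: MochizukiFrdI2008, Thm. 5.2(ii) p.100] -/
theorem isFrobenioid_chainTemperedFrobenioidR :
    PreFrobenioid.IsFrobenioid (chainTemperedFrobenioidR R S).toElem :=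
  ModelFrobenioid.isFrobenioid
    (Cor38Toy.isMonoidOn_of_punit _)
    (fun A => (isPerfFactorial_chainΦcarrier (op A)).isDivisorial)
    (Cor38Toy.isMonoidOn_of_punit _)
    ((chainTemperedFrobenioidR R S).isGroupLike_ratFnFunctor realifiedChainR.isUnit_BΛ)
    (isGraphConnected_iff_isConnected.mpr (chainTemperedFrobenioidR R S).isConnected)
    (chainTemperedFrobenioidR R S).isTotallyEpimorphic

/-- **[EtTh] Thm. 3.7 (iii) OUTRIGHT at the chain inhabitant** (for every hypothesis facade `F`, at the instantiated
facade `F.withCnst (base ⋙ 𝟭)`): abc-iut-w6-d046's `thm37_iii_withCnst_ofRlfR_chain` — whose `Prop34Cnst` input is a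
THEOREM at the chain data (discrete maximum principle) — applied to an actual `C₀`. [cite: MochizukiEtTh2009, Thm 3.7 (iii) p.79] -/
theorem thm37_iii_chainTemperedFrobenioidR (F : FrobenioidFacade.{0, 0, 0} (Discrete PUnit.{1})) :
    (chainTemperedFrobenioidR R S).Thm37_iii (F.withCnst ((chainTemperedFrobenioidR R S).base ⋙ 𝟭 (Discrete PUnit.{1}))) :=
  thm37_iii_withCnst_ofRlfR_chain (chainTemperedFrobenioidR R S) F

/-- **[EtTh] Rmk. 3.6.3 (F-0581 `Remark363`) OUTRIGHT at the chain inhabitant** (abc-iut-f-136's binder-free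
`remark363_ofRlfR`). [cite: MochizukiEtTh2009, Rmk 3.6.3 p.79] -/
theorem remark363_chainTemperedFrobenioidR : (chainTemperedFrobenioidR R S).Remark363 :=
  (chainTemperedFrobenioidR R S).remark363_ofRlfR

/-- **[EtTh] Thm. 3.7 (iv) (F-0744 `Thm37_iv`) OUTRIGHT at the chain inhabitant** ("if `D` is slim and `Λ ∈ {ℤ, ℝ}`
then `C` is slim"), by `thm37_iv_ofRlfR` + `hF`. [cite: MochizukiEtTh2009, Thm 3.7 p.80] -/
theorem thm37_iv_chainTemperedFrobenioidR : (chainTemperedFrobenioidR R S).Thm37_iv :=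
  (chainTemperedFrobenioidR R S).thm37_iv_ofRlfR dm hpf (isFrobenioid_chainTemperedFrobenioidR R S)

/-- **[EtTh] Thm. 3.7 (i), "`Λ = ℝ` ⇒ unit-trivial type", OUTRIGHT at the chain inhabitant**, by
`thm37_i_unitTrivial_ofRlfR` + `hF`. [cite: MochizukiEtTh2009, Thm 3.7 p.79] -/
theorem thm37_i_unitTrivial_chainTemperedFrobenioidR :
    PreFrobenioid.IsOfType (PreFrobenioid.IsUnitTrivial (chainTemperedFrobenioidR R S).toElem) :=
  (chainTemperedFrobenioidR R S).thm37_i_unitTrivial_ofRlfR dm hpf (isFrobenioid_chainTemperedFrobenioidR R S)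

end Sec3Prop34CnstOfRlfRChainModel

end Literature.AnabelianGeometry.EtaleTheta

end
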